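import Summits.Ventures.PercRepro.Night2LocalR1Geom

/-!
# PercRepro — R1 columns, I: the decomposition, the large sets and the triangles (night-2, gen 10)

`G` a rank-`4` flat with `|E ∖ G| = 2`, `M|G` simple with a coloop `y`, `S` a shadow set at `G`, `U := S ∖ {y}`
(of rank `3`).  The R1 column of `S` splits into its covering part — a sum over the coloops `z` of `S` whose
deletion `S ∖ {z}` is a member — and its spread part (`sum_r1W_col_eq`).

* `|U| ≥ 5`: no spread reaches `S`, at most two coloops (`card_coloops_le_two_of_simple`), each covering weight
  `≤ 5/12`: column `≤ 5/6` (`sum_r1W_col_le_of_five_le`).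
* `|U| = 3` (`U` a triangle): no spreads; the covering part is `keepW U` (the identity of `U`, if `U` is a member)
  plus the weights of the line members `S ∖ {z}`, `z ≠ y`, each at most the side weight `(5/4)/(|cl U ∖ cl (U ∖ z)| + 2)`
  of a counted side of `U`, so the column is `≤ keepW U + sideSum U ≤ 1` once `sideSum U ≤ 1`
  (`sideSum_le_one_of_card_three`: a side with `|cl U ∖ cl K| = 1` leaves the other two sides uncounted —
  `rkN_sdiff_le_two_of_subset_insert_clF` — and otherwise every side weighs `≤ 5/16`).
-/

namespace PercRepro.Shadow

open Finset PerFlat ThmH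

variable {α : Type*} [DecidableEq α] {M : Matroid α} [M.Finite]

/-! ## The column decomposition -/

open scoped Classical in
/-- The spreading members of `S`: `3`-element members with `|G ∖ cl B| = 1` and `B ∪ (G ∖ cl B) ⊆ S ⊆ G`,
`|S ∖ B| = 2`. -/
noncomputable def sprPre (M : Matroid α) [M.Finite] (G S : Finset α) : Finset (Finset α) :=
  (membersIn M (Uq M 5 3) G).filter (fun B => (G \ clF M B).card = 1 ∧ B.card = 3 ∧
    (B ∪ (G \ clF M B) ⊆ S ∧ S ⊆ G ∧ (S \ B).card = 2))

open scoped Classical in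
/-- The covering coloops of `S`: the coloops `z` of `S` with `S ∖ {z}` a member. -/
noncomputable def covZ (M : Matroid α) [M.Finite] (G S : Finset α) : Finset α :=
  (coloops M S).filter (fun z => S.erase z ∈ membersIn M (Uq M 5 3) G)

open scoped Classical in
/-- **The R1 column of `S`** = the covering part (over `covZ`) plus the spread part (over `sprPre`). -/
theorem sum_r1W_col_eq {G S : Finset α} (hS : S ∈ shadowAt M 5 3 (Uq M 5 3) G) :
    ∑ B ∈ membersIn M (Uq M 5 3) G, r1W M G B S =
      (∑ z ∈ covZ M G S, covW M G (S.erase z)) +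
        ∑ B ∈ sprPre M G S, (5 / 12 - keepW M G B) / ((G.card - 4 : ℕ) : ℚ) := by
  unfold r1W
  rw [Finset.sum_add_distrib, sum_ite_coverSets_col (Finset.Subset.refl _) hS, ← Finset.sum_filter]
  rfl

/-- A spreading member has `B ⊆ S` and `|S| = 5`. -/
theorem card_eq_five_of_mem_sprPre {G S B : Finset α} (hB : B ∈ sprPre M G S) : B ⊆ S ∧ S.card = 5 := by
  unfold sprPre at hB
  rw [Finset.mem_filter] at hB
  obtain ⟨-, -, h3, hsub, -, h2⟩ := hB
  have hBS : B ⊆ S := (Finset.subset_union_left).trans hsub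
  have := Finset.card_sdiff_add_card_eq_card hBS
  exact ⟨hBS, by omega⟩

/-- No spread reaches a set with `|S| ≠ 5`. -/
theorem sprPre_eq_empty {G S : Finset α} (h : S.card ≠ 5) : sprPre M G S = ∅ := by
  apply Finset.eq_empty_of_forall_notMem
  intro B hB
  exact h (card_eq_five_of_mem_sprPre hB).2

/-- The covering coloops are coloops. -/
theorem covZ_subset_coloops (G S : Finset α) : covZ M G S ⊆ coloops M S := Finset.filter_subset _ _

/-- The deletion of a covering coloop is a member. -/
theorem erase_mem_of_mem_covZ {G S : Finset α} {z : α} (hz : z ∈ covZ M G S) :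
    S.erase z ∈ membersIn M (Uq M 5 3) G := (Finset.mem_filter.1 hz).2

/-- A covering coloop lies in `S`. -/
theorem mem_of_mem_covZ {G S : Finset α} {z : α} (hz : z ∈ covZ M G S) : z ∈ S :=
  (mem_coloops.1 (covZ_subset_coloops G S hz)).1

/-- Every covering weight of a covering coloop is `≤ 5/12`. -/
theorem covW_erase_le {G : Finset α} (hG : G ∈ flatsQ M 4) {S : Finset α} {z : α} (hz : z ∈ covZ M G S) :
    covW M G (S.erase z) ≤ 5 / 12 :=
  covW_le G _ (one_le_card_sdiff_clF (q := 3) hG (mem_membersIn.1 (erase_mem_of_mem_covZ hz)).1)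

/-! ## `|U| ≥ 5` -/

open scoped Classical in
/-- **Large sets**: `|S ∖ {y}| ≥ 5` gives a column `≤ 5/6`. -/
theorem sum_r1W_col_le_of_five_le {G : Finset α} (hG : G ∈ flatsQ M 4)
    (hsimple : ∀ e ∈ G, ∀ f ∈ G, e ≠ f → rkN M {e, f} = 2) {y : α} (hyG : y ∈ G)
    (hycl : y ∉ clF M (G.erase y)) {S : Finset α} (hS : S ∈ shadowAt M 5 3 (Uq M 5 3) G)
    (h5 : 5 ≤ (S.erase y).card) : ∑ B ∈ membersIn M (Uq M 5 3) G, r1W M G B S ≤ 5 / 6 := by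
  have hyS := mem_of_mem_shadowAt_coloop hyG hycl hS
  have hcard : S.card ≠ 5 := by
    have := Finset.card_erase_of_mem hyS
    omega
  rw [sum_r1W_col_eq hS, sprPre_eq_empty hcard, Finset.sum_empty, add_zero]
  have hcol : (coloops M S).card ≤ 2 :=
    card_coloops_le_two_of_simple (subset_gr_of_mem_shadowAt hS) hyS
      (coloop_notMem_clF_erase_of_mem_shadowAt hycl hS)
      (simple_of_subset hsimple ((Finset.erase_subset _ _).trans (subset_of_mem_shadowAt hS)))
      (rkN_eq_four_of_mem_shadowAt hS) (by omega)
  calc ∑ z ∈ covZ M G S, covW M G (S.erase z) ≤ ∑ z ∈ covZ M G S, (5 / 12 : ℚ) :=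
        Finset.sum_le_sum (fun z hz => covW_erase_le hG hz)
    _ = (5 / 12) * ((covZ M G S).card : ℚ) := by rw [Finset.sum_const, nsmul_eq_mul]; ring
    _ ≤ (5 / 12) * 2 := by
        have h1 : (covZ M G S).card ≤ 2 := (Finset.card_le_card (covZ_subset_coloops G S)).trans hcol
        have h2 : ((covZ M G S).card : ℚ) ≤ 2 := by exact_mod_cast h1
        gcongr
    _ = 5 / 6 := by norm_num

/-! ## Sides of a rank-`3` set and the line members -/

/-- A rank-`3` subset of `G ∖ {y}` has closure `G ∖ {y}`. -/
theorem clF_eq_erase_of_rkN_three {G : Finset α} (hG : G ∈ flatsQ M 4) {y : α} (hyG : y ∈ G)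
    (hycl : y ∉ clF M (G.erase y)) {U : Finset α} (hU : U ⊆ G.erase y) (hr : rkN M U = 3) :
    clF M U = G.erase y := by
  have hsub : clF M U ⊆ G.erase y := by
    have := clF_mono (M := M) hU
    rwa [clF_erase_coloop hG hyG hycl] at this
  apply flat_eq_of_subset_of_eRk_eq (q := 2) (erase_coloop_mem_flatsQ hG hyG hycl) _ hsub
  · rw [coe_clF, M.eRk_closure_eq, eRk_eq_rkN, hr]
  · rw [coe_clF]; exact M.isFlat_closure _

/-- Hence `G ∖ cl U = {y}`. -/
theorem sdiff_clF_eq_singleton_of_rkN_three {G : Finset α} (hG : G ∈ flatsQ M 4) {y : α} (hyG : y ∈ G)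
    (hycl : y ∉ clF M (G.erase y)) {U : Finset α} (hU : U ⊆ G.erase y) (hr : rkN M U = 3) :
    G \ clF M U = {y} := by
  rw [clF_eq_erase_of_rkN_three hG hyG hycl hU hr, Finset.sdiff_erase_self hyG]

/-- `G ∖ (K ∪ {y}) = (G ∖ {y}) ∖ K`. -/
theorem sdiff_union_singleton (G K : Finset α) (y : α) : G \ (K ∪ {y}) = (G.erase y) \ K := by
  ext e
  simp only [Finset.mem_sdiff, Finset.mem_union, Finset.mem_singleton, Finset.mem_erase, not_or]
  tauto

/-- `(S ∖ {y}) ∖ {z} ∪ {y} = S ∖ {z}` for `y ∈ S`, `z ≠ y`. -/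
theorem erase_erase_union_singleton {S : Finset α} {y z : α} (hyS : y ∈ S) (hzy : z ≠ y) :
    (S.erase y).erase z ∪ {y} = S.erase z := by
  ext e
  simp only [Finset.mem_union, Finset.mem_erase, Finset.mem_singleton]
  constructor
  · rintro (⟨hez, -, heS⟩ | rfl)
    · exact ⟨hez, heS⟩
    · exact ⟨hzy.symm, hyS⟩
  · rintro ⟨hez, heS⟩
    by_cases hey : e = y
    · exact Or.inr hey
    · exact Or.inl ⟨hez, hey, heS⟩

/-- The side `U ∖ {z}` of a covering coloop `z ≠ y` of `S` (`U = S ∖ {y}`) is a counted side of `U`. -/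
theorem erase_mem_sides {G : Finset α} (hG : G ∈ flatsQ M 4) (hd : (gr M \ G).card = 2) {y : α}
    (hyG : y ∈ G) (hycl : y ∉ clF M (G.erase y)) {S : Finset α} (hS : S ∈ shadowAt M 5 3 (Uq M 5 3) G)
    (h3 : (S.erase y).card = 3) {z : α} (hz : z ∈ covZ M G S) (hzy : z ≠ y) :
    (S.erase y).erase z ∈ ((S.erase y).powersetCard 2).filter
      (fun K => 3 ≤ rkN M (G \ (K ∪ (G \ clF M (S.erase y))))) := by
  have hyS := mem_of_mem_shadowAt_coloop hyG hycl hS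
  have hzS := mem_of_mem_covZ hz
  have hzU : z ∈ S.erase y := Finset.mem_erase.2 ⟨hzy, hzS⟩
  rw [Finset.mem_filter, Finset.mem_powersetCard]
  refine ⟨⟨Finset.erase_subset _ _, by rw [Finset.card_erase_of_mem hzU, h3]⟩, ?_⟩
  rw [sdiff_clF_eq_singleton_of_rkN_three hG hyG hycl (erase_subset_erase_of_mem_shadowAt hS)
    (rkN_erase_of_mem_shadowAt hG hyG hycl hS), erase_erase_union_singleton hyS hzy]
  exact three_le_rkN_sdiff_of_member hd (erase_mem_of_mem_covZ hz)

/-- The covering weight of a line member `S ∖ {z}`, `z ≠ y`, is at most the side weight of `U ∖ {z}`. -/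
theorem covW_erase_le_side {G : Finset α} (hG : G ∈ flatsQ M 4) {y : α} (hyG : y ∈ G)
    (hycl : y ∉ clF M (G.erase y)) {S : Finset α} (hS : S ∈ shadowAt M 5 3 (Uq M 5 3) G) {z : α}
    (hz : z ∈ covZ M G S) (hzy : z ≠ y) :
    covW M G (S.erase z) ≤
      (5 / 4) / (((clF M (S.erase y) \ clF M ((S.erase y).erase z)).card : ℚ) + 2) := by
  have hyS := mem_of_mem_shadowAt_coloop hyG hycl hS
  have hB := erase_mem_of_mem_covZ hz
  have hyB : y ∈ S.erase z := Finset.mem_erase.2 ⟨hzy.symm, hyS⟩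
  have hcard := card_sdiff_clF_of_member_mem hG hyG hycl hB hyB
  rw [Finset.erase_right_comm, ← clF_eq_erase_of_rkN_three hG hyG hycl
    (erase_subset_erase_of_mem_shadowAt hS) (rkN_erase_of_mem_shadowAt hG hyG hycl hS)] at hcard
  calc covW M G (S.erase z) ≤ (5 / 4) / (((G \ clF M (S.erase z)).card : ℚ) + 2) := covW_le_cov G _
    _ = (5 / 4) / (((clF M (S.erase y) \ clF M ((S.erase y).erase z)).card : ℚ) + 2) := by rw [hcard]

open scoped Classical in
/-- **The line members of a triangle set are bounded by its side sum**: for `|U| = 3`,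
`Σ_{z ∈ covZ, z ≠ y} covW (S ∖ {z}) ≤ sideSum U`. -/
theorem sum_covW_erase_le_sideSum {G : Finset α} (hG : G ∈ flatsQ M 4) (hd : (gr M \ G).card = 2) {y : α}
    (hyG : y ∈ G) (hycl : y ∉ clF M (G.erase y)) {S : Finset α} (hS : S ∈ shadowAt M 5 3 (Uq M 5 3) G)
    (h3 : (S.erase y).card = 3) :
    ∑ z ∈ (covZ M G S).erase y, covW M G (S.erase z) ≤ sideSum M G (S.erase y) := by
  have hyS := mem_of_mem_shadowAt_coloop hyG hycl hS
  calc ∑ z ∈ (covZ M G S).erase y, covW M G (S.erase z)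
      ≤ ∑ z ∈ (covZ M G S).erase y,
          (5 / 4) / (((clF M (S.erase y) \ clF M ((S.erase y).erase z)).card : ℚ) + 2) := by
        apply Finset.sum_le_sum
        intro z hz
        rw [Finset.mem_erase] at hz
        exact covW_erase_le_side hG hyG hycl hS hz.2 hz.1
    _ = ∑ K ∈ ((covZ M G S).erase y).image (fun z => (S.erase y).erase z),
          (5 / 4) / (((clF M (S.erase y) \ clF M K).card : ℚ) + 2) := by
        rw [Finset.sum_image]
        intro z hz z' hz' h
        rw [Finset.coe_erase, Set.mem_sdiff, Set.mem_singleton_iff, Finset.mem_coe] at hz hz'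
        have hzU : z ∈ S.erase y := Finset.mem_erase.2 ⟨hz.2, mem_of_mem_covZ hz.1⟩
        exact (Finset.erase_inj (S.erase y) hzU).1 h
    _ ≤ sideSum M G (S.erase y) := by
        unfold sideSum
        apply Finset.sum_le_sum_of_subset_of_nonneg
        · intro K hK
          rw [Finset.mem_image] at hK
          obtain ⟨z, hz, rfl⟩ := hK
          rw [Finset.mem_erase] at hz
          exact erase_mem_sides hG hd hyG hycl hS h3 hz.2 hz.1
        · intro K _ _
          positivity

/-! ## The side sum of a triangle is at most `1` -/

/-- A side `K` of a rank-`3` set has `cl K ⊊ cl U`: `|cl U ∖ cl K| ≥ 1`. -/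
theorem one_le_card_clF_sdiff_of_card_two {U K : Finset α} (hU : U ⊆ gr M) (hr : rkN M U = 3)
    (h2 : K.card = 2) : 1 ≤ (clF M U \ clF M K).card := by
  by_contra h
  push Not at h
  have hsub : clF M U ⊆ clF M K := by
    intro e he
    by_contra heK
    have : e ∈ clF M U \ clF M K := Finset.mem_sdiff.2 ⟨he, heK⟩
    have := Finset.card_pos.2 ⟨e, this⟩
    omega
  have h1 : rkN M U ≤ rkN M K := by
    have := rkN_mono (M := M) ((subset_clF_of_subset_gr hU).trans hsub)
    rwa [rkN_clF] at this
  have h2' := rkN_le_card (M := M) K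
  omega

/-- The complement of a side with `|cl U ∖ cl K| = 1` pins the other two sides: if `K₀ = {a, b} ⊆ U`, `|U| = 3`,
`U` has rank `3` and `cl U ∖ cl K₀ = {c}`, then `cl U ⊆ insert c (cl {a, b})` and the third point of `U` is `c`. -/
theorem clF_subset_insert_of_card_one {U K₀ : Finset α} (hU : U ⊆ gr M) (hr : rkN M U = 3) (h3 : U.card = 3)
    (hK₀ : K₀ ⊆ U) (h2 : K₀.card = 2) (hc : (clF M U \ clF M K₀).card = 1) :
    ∃ c ∈ U, c ∉ K₀ ∧ U = insert c K₀ ∧ clF M U ⊆ insert c (clF M K₀) := by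
  obtain ⟨c, hcU, hcK₀⟩ := Finset.exists_of_ssubset (Finset.ssubset_iff_subset_ne.2 ⟨hK₀, fun h => by
    rw [h] at h2; omega⟩)
  have hUeq : U = insert c K₀ := by
    apply (Finset.eq_of_subset_of_card_le (Finset.insert_subset hcU hK₀) _).symm
    rw [Finset.card_insert_of_notMem hcK₀, h2, h3]
  have hccl : c ∉ clF M K₀ := by
    intro hcl
    have h1 := rkN_insert_le_of_mem_clF (hK₀.trans hU) hcl
    have h2' := rkN_le_card (M := M) K₀
    rw [← hUeq, hr] at h1
    omega
  have hcmem : c ∈ clF M U \ clF M K₀ := Finset.mem_sdiff.2 ⟨subset_clF_of_subset_gr hU hcU, hccl⟩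
  obtain ⟨c', hc'⟩ := Finset.card_eq_one.1 hc
  have hcc' : c = c' := by
    have := hcmem; rw [hc', Finset.mem_singleton] at this; exact this
  refine ⟨c, hcU, hcK₀, hUeq, ?_⟩
  intro p hp
  rw [Finset.mem_insert]
  by_cases hpK : p ∈ clF M K₀
  · exact Or.inr hpK
  · left
    have : p ∈ clF M U \ clF M K₀ := Finset.mem_sdiff.2 ⟨hp, hpK⟩
    rw [hc', Finset.mem_singleton] at this
    rw [this, hcc']

/-- A `2`-subset `K ≠ K₀` of `U = insert c K₀` (`|K₀| = 2`, `c ∉ K₀`) is `{c, d}` with `d ∈ K₀`. -/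
theorem eq_pair_of_ne {U K₀ K : Finset α} {c : α} (hcK₀ : c ∉ K₀) (hUeq : U = insert c K₀) (h2 : K₀.card = 2)
    (hK : K ⊆ U) (hK2 : K.card = 2) (hne : K ≠ K₀) : ∃ d ∈ K₀, K = {c, d} := by
  have hcK : c ∈ K := by
    by_contra hcK
    apply hne
    apply Finset.eq_of_subset_of_card_le
    · intro e he
      have := hK he
      rw [hUeq, Finset.mem_insert] at this
      rcases this with rfl | h
      · exact absurd he hcK
      · exact h
    · omega
  obtain ⟨d, hd⟩ := Finset.card_eq_one.1 (show (K.erase c).card = 1 by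
    rw [Finset.card_erase_of_mem hcK, hK2])
  have hdK : d ∈ K.erase c := hd ▸ Finset.mem_singleton_self d
  rw [Finset.mem_erase] at hdK
  refine ⟨d, ?_, ?_⟩
  · have := hK hdK.2
    rw [hUeq, Finset.mem_insert] at this
    rcases this with h | h
    · exact absurd h hdK.1
    · exact h
  · rw [← Finset.insert_erase hcK, hd]

open scoped Classical in
/-- **The side sum of a triangle is at most `1`.** -/
theorem sideSum_le_one_of_card_three {G : Finset α} (hG : G ∈ flatsQ M 4) {y : α} (hyG : y ∈ G)
    (hycl : y ∉ clF M (G.erase y)) {U : Finset α} (hU : U ⊆ G.erase y) (hr : rkN M U = 3)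
    (h3 : U.card = 3) : sideSum M G U ≤ 1 := by
  have hGg := (mem_flatsQ.1 hG).1
  have hUg : U ⊆ gr M := hU.trans ((Finset.erase_subset _ _).trans hGg)
  have hclU : clF M U = G.erase y := clF_eq_erase_of_rkN_three hG hyG hycl hU hr
  have hsd : G \ clF M U = {y} := sdiff_clF_eq_singleton_of_rkN_three hG hyG hycl hU hr
  unfold sideSum
  set F := (U.powersetCard 2).filter (fun K => 3 ≤ rkN M (G \ (K ∪ (G \ clF M U)))) with hF
  have hFsub : ∀ K ∈ F, K ⊆ U ∧ K.card = 2 ∧ 3 ≤ rkN M ((G.erase y) \ K) := by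
    intro K hK
    rw [hF, Finset.mem_filter, Finset.mem_powersetCard, hsd, sdiff_union_singleton] at hK
    exact ⟨hK.1.1, hK.1.2, hK.2⟩
  have hterm : ∀ K ∈ F, (5 / 4) / (((clF M U \ clF M K).card : ℚ) + 2) ≤ 5 / 12 := by
    intro K hK
    obtain ⟨hKU, hK2, -⟩ := hFsub K hK
    have h1 := one_le_card_clF_sdiff_of_card_two hUg hr hK2
    have h1' : (1 : ℚ) ≤ ((clF M U \ clF M K).card : ℚ) := by exact_mod_cast h1
    rw [div_le_iff₀ (by linarith)]
    linarith
  by_cases hex : ∃ K ∈ F, (clF M U \ clF M K).card = 1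
  · obtain ⟨K₀, hK₀, hc⟩ := hex
    obtain ⟨hK₀U, hK₀2, -⟩ := hFsub K₀ hK₀
    obtain ⟨c, hcU, hcK₀, hUeq, hclsub⟩ := clF_subset_insert_of_card_one hUg hr h3 hK₀U hK₀2 hc
    obtain ⟨a, b, hab, hK₀ab⟩ := Finset.card_eq_two.1 hK₀2
    have hFeq : F = {K₀} := by
      rw [Finset.eq_singleton_iff_unique_mem]
      refine ⟨hK₀, fun K hK => ?_⟩
      by_contra hne
      obtain ⟨hKU, hK2, hKr⟩ := hFsub K hK
      obtain ⟨d, hdK₀, hKcd⟩ := eq_pair_of_ne hcK₀ hUeq hK₀2 hKU hK2 hne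
      have hP : G.erase y ⊆ insert c (clF M {a, b}) := by
        rw [← hclU, ← hK₀ab]; exact hclsub
      rw [hK₀ab, Finset.mem_insert, Finset.mem_singleton] at hdK₀
      rw [hKcd, Finset.pair_comm] at hKr
      rcases hdK₀ with rfl | rfl
      · have := rkN_sdiff_le_two_of_subset_insert_clF hP
        omega
      · rw [Finset.pair_comm] at hP
        have := rkN_sdiff_le_two_of_subset_insert_clF hP
        omega
    rw [hFeq, Finset.sum_singleton]
    exact (hterm K₀ hK₀).trans (by norm_num)
  · push Not at hex
    have hterm' : ∀ K ∈ F, (5 / 4) / (((clF M U \ clF M K).card : ℚ) + 2) ≤ 5 / 16 := by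
      intro K hK
      obtain ⟨hKU, hK2, -⟩ := hFsub K hK
      have h1 := one_le_card_clF_sdiff_of_card_two hUg hr hK2
      have h2 : 2 ≤ (clF M U \ clF M K).card := Nat.lt_of_le_of_ne h1 (Ne.symm (hex K hK))
      have h2' : (2 : ℚ) ≤ ((clF M U \ clF M K).card : ℚ) := by exact_mod_cast h2
      rw [div_le_iff₀ (by linarith)]
      linarith
    have hcard : F.card ≤ 3 := by
      calc F.card ≤ (U.powersetCard 2).card := Finset.card_filter_le _ _
        _ = Nat.choose 3 2 := by rw [Finset.card_powersetCard, h3]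
        _ = 3 := by decide
    calc ∑ K ∈ F, (5 / 4) / (((clF M U \ clF M K).card : ℚ) + 2) ≤ ∑ K ∈ F, (5 / 16 : ℚ) :=
          Finset.sum_le_sum hterm'
      _ = (5 / 16) * (F.card : ℚ) := by rw [Finset.sum_const, nsmul_eq_mul]; ring
      _ ≤ (5 / 16) * 3 := by
          have : (F.card : ℚ) ≤ 3 := by exact_mod_cast hcard
          gcongr
      _ ≤ 1 := by norm_num

/-! ## `|U| = 3` -/

open scoped Classical in
/-- **Triangles**: `|S ∖ {y}| = 3` gives a column `≤ keepW U + sideSum U ≤ 1`. -/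
theorem sum_r1W_col_le_one_of_card_three {G : Finset α} (hG : G ∈ flatsQ M 4) (hd : (gr M \ G).card = 2)
    {y : α} (hyG : y ∈ G) (hycl : y ∉ clF M (G.erase y)) {S : Finset α}
    (hS : S ∈ shadowAt M 5 3 (Uq M 5 3) G) (h3 : (S.erase y).card = 3) :
    ∑ B ∈ membersIn M (Uq M 5 3) G, r1W M G B S ≤ 1 := by
  have hyS := mem_of_mem_shadowAt_coloop hyG hycl hS
  have hcard : S.card ≠ 5 := by
    have := Finset.card_erase_of_mem hyS
    omega
  have hU : S.erase y ⊆ G.erase y := erase_subset_erase_of_mem_shadowAt hS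
  have hr : rkN M (S.erase y) = 3 := rkN_erase_of_mem_shadowAt hG hyG hycl hS
  have hside := sideSum_le_one_of_card_three hG hyG hycl hU hr h3
  have hkeep := keepW_le_one_sub (M := M) G (S.erase y) hside
  have hsum := sum_covW_erase_le_sideSum hG hd hyG hycl hS h3
  rw [sum_r1W_col_eq hS, sprPre_eq_empty hcard, Finset.sum_empty, add_zero]
  by_cases hyZ : y ∈ covZ M G S
  · rw [← Finset.add_sum_erase _ _ hyZ]
    have hcov : covW M G (S.erase y) ≤ keepW M G (S.erase y) := by
      unfold covW
      rw [if_pos (by rw [sdiff_clF_eq_singleton_of_rkN_three hG hyG hycl hU hr]; rfl), if_pos h3]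
    linarith
  · rw [Finset.erase_eq_of_notMem hyZ] at hsum
    linarith [keepW_nonneg (M := M) G (S.erase y)]

end PercRepro.Shadow
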